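import Summits.KontsevichZagierPeriods.KontsevichZagierPeriods.Theses.HurwitzMicroSectors
import Literature.NumberTheory.Transcendental.KZLogCalculusProofs
import Literature.NumberTheory.Transcendental.KZProductIdeal
import Literature.NumberTheory.Transcendental.KZSemialgebraicComplex
import Literature.NumberTheory.Transcendental.SemialgebraicLineDeriv

/-!
# `HurwitzSectorComplement` (stmt-KontsevichZagierPeriods-14341, route HurwitzMicroSectors),
# line `chebyshev-level-deformation`: stub `stub_ladderBottom` (S2) — the fibre Möbius chart

At box dimension `1` (ambient dimension `1 + j`: the box coordinate `x = z (Fin.castAdd j 0)`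
first, then the `j` parameters `z (Fin.natAdd 1 i)` which, capped by `V`, form a strictly
decreasing positive chain with last entry `κ`), the Bernoulli-parity kernel is
`U(κ; x) = 2κ / ((1 − x)² + κ²(1 + x)²)`, and the fibre Möbius chart
`x ↦ W = κ (1 + x)/(1 − x)` maps `(0,1)` onto `(κ, ∞)` with `U(κ; x) dx = dW/(1 + W²)`.
This is ONE change of variables (rule (2) of the Kontsevich–Zagier calculus) in dimension
`1 + j`, `Φ(z) = z` with the box slot replaced by `W(z)`; its derivative is the identity matrix
with the slot row replaced by the gradient of `W`, so `det Φ'(z) = ∂W/∂x = 2κ/(1 − x)² > 0`;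
it is injective (`x ↦ W` is strictly increasing, the parameters are untouched) with image the
region `B(j,V) = {chain strictly decreasing, 0 < κ < W}` (inverse `x = (W − κ)/(W + κ)`), and
`Ω · U(κ;x) = Ω · (1/(1 + W²)) · |det Φ'|` because `(1 − x)² (1 + W²) = (1 − x)² + κ²(1 + x)²`.
The output representation `b = [B(j,V), Ω · 1/(1 + W²)]` is integrable because integrability
transfers along the chart (`MeasureTheory.integrableOn_image_iff_integrableOn_abs_det_fderiv_smul`)
and `ℚ`-semialgebraic because images of semialgebraic sets under semialgebraic maps are
(Tarski–Seidenberg, `IsSemialgebraicMapOn.isSemialgebraic_image_holds`).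

The chart is developed for an abstract "slot" and an abstract parameter function `κ` that does
not depend on the slot coordinate (`LadderBottom.exists_rep_of_chart`); the stub instantiates
`κ z = (Fin.cons V (z ∘ Fin.natAdd 1)) (Fin.last j)`.

References: M. Kontsevich, D. Zagier, *Periods* (2001), §1.2 rule (2).
-/

noncomputable section

open Set MeasureTheory
open scoped BigOperators
open Literature.NumberTheory.Transcendental
open Literature.ModelTheory.ExponentialFields (IsSemialgebraic)

namespace Summit.KontsevichZagierPeriods.Theorems.HurwitzMicroSectorsHurwitzSectorComplement

namespace LadderBottom

/-! ### Linear algebra: the derivative of a one-slot update and its determinant -/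

/-- The determinant of the identity with one row replaced: if `Φ'` is the continuous linear map
whose coordinates are the coordinate projections except in the slot `slot`, where it is `L`, then
`det Φ' = L(e_slot)` (Cramer's rule for the identity matrix). [folklore] -/
theorem det_pi_update {n : ℕ} (slot : Fin n) (L : (Fin n → ℝ) →L[ℝ] ℝ) :
    (ContinuousLinearMap.pi (Function.update
      (fun k : Fin n => (ContinuousLinearMap.proj k : (Fin n → ℝ) →L[ℝ] ℝ)) slot L)).det
      = L (Pi.single slot 1) := by
  rw [ContinuousLinearMap.det, ← LinearMap.det_toMatrix']
  have hM : LinearMap.toMatrix' ((ContinuousLinearMap.pi (Function.update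
      (fun k : Fin n => (ContinuousLinearMap.proj k : (Fin n → ℝ) →L[ℝ] ℝ)) slot L) :
        (Fin n → ℝ) →L[ℝ] (Fin n → ℝ)) : (Fin n → ℝ) →ₗ[ℝ] (Fin n → ℝ))
      = Matrix.updateRow (1 : Matrix (Fin n) (Fin n) ℝ) slot (fun l => L (Pi.single l 1)) := by
    ext k l
    rw [LinearMap.toMatrix'_apply, ContinuousLinearMap.coe_coe, ContinuousLinearMap.pi_apply,
      Matrix.updateRow_apply]
    rcases eq_or_ne k slot with rfl | hk
    · rw [Function.update_self, if_pos rfl]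
    · rw [Function.update_of_ne hk, if_neg hk, ContinuousLinearMap.proj_apply, Matrix.one_apply,
        Pi.single_apply]
  rw [hM, ← Matrix.cramer_transpose_apply, Matrix.transpose_one, Matrix.cramer_one]
  rfl

/-- The derivative of a one-slot update `z ↦ update z slot (W z)`: the coordinate projections
except in the slot, where it is the derivative of `W`. [folklore] -/
theorem hasFDerivAt_update {n : ℕ} (slot : Fin n) {W : (Fin n → ℝ) → ℝ}
    {W' : (Fin n → ℝ) →L[ℝ] ℝ} {z : Fin n → ℝ} (hW : HasFDerivAt W W' z) :
    HasFDerivAt (fun y : Fin n → ℝ => Function.update y slot (W y))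
      (ContinuousLinearMap.pi (Function.update
        (fun k : Fin n => (ContinuousLinearMap.proj k : (Fin n → ℝ) →L[ℝ] ℝ)) slot W')) z := by
  rw [hasFDerivAt_pi']
  intro k
  rcases eq_or_ne k slot with rfl | hk
  · have h1 : (fun y : Fin n → ℝ => Function.update y k (W y) k) = W :=
      funext fun y => Function.update_self ..
    have h2 : (ContinuousLinearMap.proj k).comp (ContinuousLinearMap.pi (Function.update
        (fun k : Fin n => (ContinuousLinearMap.proj k : (Fin n → ℝ) →L[ℝ] ℝ)) k W')) = W' := by
      ext v
      simp
    rw [h1, h2]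
    exact hW
  · have h1 : (fun y : Fin n → ℝ => Function.update y slot (W y) k) = fun y => y k :=
      funext fun y => Function.update_of_ne hk ..
    have h2 : (ContinuousLinearMap.proj k).comp (ContinuousLinearMap.pi (Function.update
        (fun k : Fin n => (ContinuousLinearMap.proj k : (Fin n → ℝ) →L[ℝ] ℝ)) slot W'))
          = ContinuousLinearMap.proj k := by
      ext v
      simp [Function.update_of_ne hk]
    rw [h1, h2]
    exact hasFDerivAt_apply k z

/-! ### The Möbius factor `(1 + x)/(1 - x)` and the slot function `W = κ · (1 + x)/(1 - x)` -/

/-- `d/dx (1 + x)/(1 - x) = 2/(1 - x)²` off `x = 1`. [folklore] -/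
theorem hasDerivAt_mobius {x : ℝ} (hx : x ≠ 1) :
    HasDerivAt (fun s : ℝ => (1 + s) / (1 - s)) (2 / (1 - x) ^ 2) x := by
  have h1 : HasDerivAt (fun s : ℝ => 1 + s) 1 x := (hasDerivAt_id x).const_add 1
  have h2 : HasDerivAt (fun s : ℝ => 1 - s) (-1) x := by
    simpa using (hasDerivAt_id x).const_sub 1
  have hx' : (1 - x) ≠ 0 := sub_ne_zero.mpr (Ne.symm hx)
  refine (h1.div h2 hx').congr_deriv ?_
  ring

/-- The derivative of `W(z) = κ(z) · (1 + z_slot)/(1 - z_slot)` (product rule). [folklore] -/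
theorem hasFDerivAt_W {n : ℕ} (slot : Fin n) {κ : (Fin n → ℝ) → ℝ} {κ' : (Fin n → ℝ) →L[ℝ] ℝ}
    {z : Fin n → ℝ} (hκ : HasFDerivAt κ κ' z) (hz : z slot ≠ 1) :
    HasFDerivAt (fun y : Fin n → ℝ => κ y * ((1 + y slot) / (1 - y slot)))
      (κ z • ((2 / (1 - z slot) ^ 2) • ContinuousLinearMap.proj slot) +
        ((1 + z slot) / (1 - z slot)) • κ') z := by
  have hm := (hasDerivAt_mobius hz).comp_hasFDerivAt z (hasFDerivAt_apply (𝕜 := ℝ) slot z)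
  refine (hκ.mul hm).congr_fderiv ?_
  rfl

/-- `U(κ; x) dx = dW/(1 + W²)`: the kernel identity
`2κ/((1 − x)² + κ²(1 + x)²) = (1/(1 + W²)) · (2κ/(1 − x)²)`, `W = κ(1 + x)/(1 − x)`. [folklore] -/
theorem kernel_identity {κ x : ℝ} (hκ : 0 < κ) (hx1 : x < 1) :
    2 * κ / ((1 - x) ^ 2 + κ ^ 2 * (1 + x) ^ 2)
      = 1 / (1 + (κ * ((1 + x) / (1 - x))) ^ 2) * (κ * (2 / (1 - x) ^ 2)) := by
  have h1 : (1 - x) ≠ 0 := (sub_pos.mpr hx1).ne'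
  have hD : (1 - x) ^ 2 + κ ^ 2 * (1 + x) ^ 2 ≠ 0 := by positivity
  field_simp

/-! ### The chart `Φ(z) = update z slot (W z)`: injectivity, image, semialgebraicity -/

/-- The chart is injective on any set where `z_slot < 1` and `κ ≠ 0`, provided `κ` does not
depend on the slot coordinate. [folklore] -/
theorem injOn_chart {n : ℕ} (slot : Fin n) {κ : (Fin n → ℝ) → ℝ} {S : Set (Fin n → ℝ)}
    (hκu : ∀ z t, κ (Function.update z slot t) = κ z)
    (hκ0 : ∀ z ∈ S, κ z ≠ 0) (hS : ∀ z ∈ S, z slot < 1) :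
    InjOn (fun z : Fin n → ℝ => Function.update z slot (κ z * ((1 + z slot) / (1 - z slot)))) S := by
  intro z₁ h₁ z₂ h₂ h
  have hk : ∀ k, k ≠ slot → z₁ k = z₂ k := fun k hk => by
    have := congr_fun h k
    simpa only [Function.update_of_ne hk] using this
  have hz₂ : z₂ = Function.update z₁ slot (z₂ slot) := by
    funext k
    rcases eq_or_ne k slot with rfl | hk'
    · rw [Function.update_self]
    · rw [Function.update_of_ne hk', hk k hk']
  have hκ : κ z₂ = κ z₁ := by rw [hz₂, hκu]
  have hW := congr_fun h slot
  simp only [Function.update_self] at hW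
  rw [hκ] at hW
  have hm := mul_left_cancel₀ (hκ0 z₁ h₁) hW
  have e1 : (1 - z₁ slot) ≠ 0 := (sub_pos.mpr (hS z₁ h₁)).ne'
  have e2 : (1 - z₂ slot) ≠ 0 := (sub_pos.mpr (hS z₂ h₂)).ne'
  rw [div_eq_div_iff e1 e2] at hm
  have hx : z₁ slot = z₂ slot := by linear_combination (1 / 2 : ℝ) * hm
  rw [hz₂, ← hx, Function.update_eq_self]

/-- The image of `{z_slot ∈ (0,1), A, 0 < κ}` under the chart is `{A, 0 < κ, κ < W}`, when the
side condition `A` and `κ` do not depend on the slot coordinate (inverse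
`x = (W − κ)/(W + κ)`). [folklore] -/
theorem image_chart {n : ℕ} (slot : Fin n) {κ : (Fin n → ℝ) → ℝ} {A : (Fin n → ℝ) → Prop}
    (hκu : ∀ z t, κ (Function.update z slot t) = κ z)
    (hAu : ∀ z t, A (Function.update z slot t) ↔ A z) :
    (fun z : Fin n → ℝ => Function.update z slot (κ z * ((1 + z slot) / (1 - z slot)))) ''
        {z | z slot ∈ Ioo (0:ℝ) 1 ∧ A z ∧ 0 < κ z}
      = {y | A y ∧ 0 < κ y ∧ κ y < y slot} := by
  ext y
  constructor
  · rintro ⟨z, ⟨⟨hx0, hx1⟩, hA, hκ⟩, rfl⟩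
    dsimp only
    refine ⟨(hAu z _).mpr hA, by rwa [hκu], ?_⟩
    · rw [hκu, Function.update_self]
      have h1 : 0 < 1 - z slot := by linarith
      rw [lt_mul_iff_one_lt_right hκ, one_lt_div h1]
      linarith
  · rintro ⟨hA, hκ, hlt⟩
    have hpos : 0 < y slot + κ y := by linarith
    refine ⟨Function.update y slot ((y slot - κ y) / (y slot + κ y)),
      ⟨?_, (hAu y _).mpr hA, by rwa [hκu]⟩, ?_⟩
    · rw [Function.update_self]
      exact ⟨div_pos (by linarith) hpos, by rw [div_lt_one hpos]; linarith⟩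
    · simp only [Function.update_idem, Function.update_self, hκu]
      conv_rhs => rw [← Function.update_eq_self slot y]
      congr 1
      have h1 : 1 + (y slot - κ y) / (y slot + κ y) = 2 * y slot / (y slot + κ y) := by
        field_simp
        ring
      have h2 : 1 - (y slot - κ y) / (y slot + κ y) = 2 * κ y / (y slot + κ y) := by
        field_simp
        ring
      rw [h1, h2]
      field_simp

/-- The chart is a `ℚ`-semialgebraic map on any `ℚ`-semialgebraic set where `κ` is
`ℚ`-semialgebraic and `z_slot < 1` (rational coordinates). [folklore] -/
theorem isSemialgebraicMapOn_chart {n : ℕ} (slot : Fin n) {κ : (Fin n → ℝ) → ℝ}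
    {S : Set (Fin n → ℝ)} (hS : IsSemialgebraic ℚ S) (hκ : IsSemialgebraicFunOn ℚ S κ)
    (hS1 : ∀ z ∈ S, z slot < 1) :
    IsSemialgebraicMapOn ℚ S
      (fun z : Fin n → ℝ => Function.update z slot (κ z * ((1 + z slot) / (1 - z slot)))) := by
  refine IsSemialgebraicMapOn.of_forall hS fun k => ?_
  rcases eq_or_ne k slot with rfl | hk
  · simp only [Function.update_self]
    refine hκ.fun_mul ?_
    refine (isSemialgebraicFunOn_aeval_div_aeval hS (1 + MvPolynomial.X k : MvPolynomial (Fin n) ℚ)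
      (1 - MvPolynomial.X k) fun z hz => ?_).congr fun z _ => ?_
    · simp only [map_sub, map_one, MvPolynomial.aeval_X]
      exact (sub_pos.mpr (hS1 z hz)).ne'
    · simp
  · simp only [Function.update_of_ne hk]
    exact isSemialgebraicFunOn_apply hS k

/-- The output integrand `Ω(y) · 1/(1 + W²)` is `ℚ`-semialgebraic wherever `Ω` is. [folklore] -/
theorem isSemialgebraicFunOn_out {n : ℕ} (slot : Fin n) {Ω : (Fin n → ℝ) → ℝ}
    {B : Set (Fin n → ℝ)} (hB : IsSemialgebraic ℚ B) (hΩ : IsSemialgebraicFunOn ℚ B Ω) :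
    IsSemialgebraicFunOn ℚ B (fun y => Ω y * (1 / (1 + y slot ^ 2))) := by
  refine hΩ.fun_mul ?_
  refine (isSemialgebraicFunOn_aeval_div_aeval hB (1 : MvPolynomial (Fin n) ℚ)
    (1 + MvPolynomial.X slot ^ 2) fun z _ => ?_).congr fun z _ => ?_
  · simp only [map_add, map_one, map_pow, MvPolynomial.aeval_X]
    positivity
  · simp

/-! ### The move, for an abstract slot and parameter function -/

/-- **The fibre Möbius chart is ONE change of variables** (abstract form). For a slot `slot`, a
parameter function `κ` with constant derivative `κ'` killing `e_slot` and not depending on the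
slot coordinate, a slot-independent side condition `A` and weight `Ω` (both `ℚ`-semialgebraic
data), and a representation `r = [{z_slot ∈ (0,1), A, 0 < κ}, Ω · U(κ; z_slot)]`, there is a
representation `b = [{A, 0 < κ < y_slot}, Ω · 1/(1 + y_slot²)]` with `[r] − [b]` a
change-of-variables relation. [cite: KontsevichZagier2001, §1.2 rule (2)] -/
theorem exists_rep_of_chart {n : ℕ} (slot : Fin n) (κ : (Fin n → ℝ) → ℝ)
    (κ' : (Fin n → ℝ) →L[ℝ] ℝ) (A : (Fin n → ℝ) → Prop) (Ω : (Fin n → ℝ) → ℝ) (U : ℝ → ℝ → ℝ)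
    (hU : ∀ v s, U v s = 2 * v / ((1 - s) ^ 2 + v ^ 2 * (1 + s) ^ 2))
    (hκd : ∀ z, HasFDerivAt κ κ' z) (hκ's : κ' (Pi.single slot 1) = 0)
    (hκu : ∀ z t, κ (Function.update z slot t) = κ z)
    (hAu : ∀ z t, A (Function.update z slot t) ↔ A z)
    (hΩu : ∀ z t, Ω (Function.update z slot t) = Ω z)
    (hκs : ∀ S : Set (Fin n → ℝ), IsSemialgebraic ℚ S → IsSemialgebraicFunOn ℚ S κ)
    (hΩs : ∀ S : Set (Fin n → ℝ), IsSemialgebraic ℚ S → IsSemialgebraicFunOn ℚ S Ω)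
    (r : KZ.IntegralRep n) (hdom : r.domain = {z | z slot ∈ Ioo (0:ℝ) 1 ∧ A z ∧ 0 < κ z})
    (hint : EqOn r.integrand (fun z => Ω z * U (κ z) (z slot)) r.domain) :
    ∃ b : KZ.IntegralRep n, b.domain = {y | A y ∧ 0 < κ y ∧ κ y < y slot} ∧
      EqOn b.integrand (fun y => Ω y * (1 / (1 + y slot ^ 2))) b.domain ∧
      KZ.of r - KZ.of b ∈ KZ.relations := by
  -- the chart and its derivative
  let Φ : (Fin n → ℝ) → (Fin n → ℝ) :=
    fun z => Function.update z slot (κ z * ((1 + z slot) / (1 - z slot)))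
  let Φ' : (Fin n → ℝ) → (Fin n → ℝ) →L[ℝ] (Fin n → ℝ) := fun z =>
    ContinuousLinearMap.pi (Function.update
      (fun k : Fin n => (ContinuousLinearMap.proj k : (Fin n → ℝ) →L[ℝ] ℝ)) slot
      (κ z • ((2 / (1 - z slot) ^ 2) • ContinuousLinearMap.proj slot) +
        ((1 + z slot) / (1 - z slot)) • κ'))
  let B : Set (Fin n → ℝ) := {y | A y ∧ 0 < κ y ∧ κ y < y slot}
  let F : (Fin n → ℝ) → ℝ := fun y => Ω y * (1 / (1 + y slot ^ 2))
  -- facts on the domain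
  have hS : IsSemialgebraic ℚ r.domain := r.isSemialgebraic_domain
  have hmeas : MeasurableSet r.domain := KZ.IntegralRep.measurableSet_domain_holds r
  have hx1 : ∀ z ∈ r.domain, z slot < 1 := fun z hz => by
    rw [hdom] at hz
    exact hz.1.2
  have hκ0 : ∀ z ∈ r.domain, 0 < κ z := fun z hz => by
    rw [hdom] at hz
    exact hz.2.2
  -- the chart data
  have hΦs : IsSemialgebraicMapOn ℚ r.domain Φ :=
    isSemialgebraicMapOn_chart slot hS (hκs _ hS) hx1
  have hderiv : ∀ z ∈ r.domain, HasFDerivWithinAt Φ (Φ' z) r.domain z := fun z hz =>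
    (hasFDerivAt_update slot (hasFDerivAt_W slot (hκd z) (hx1 z hz).ne)).hasFDerivWithinAt
  have hinj : InjOn Φ r.domain := injOn_chart slot hκu (fun z hz => (hκ0 z hz).ne') hx1
  have himage : Φ '' r.domain = B := by
    rw [hdom]
    exact image_chart slot hκu hAu
  have hdet : ∀ z ∈ r.domain, |(Φ' z).det| = κ z * (2 / (1 - z slot) ^ 2) := fun z hz => by
    have h : (Φ' z).det = κ z * (2 / (1 - z slot) ^ 2) := by
      rw [det_pi_update]
      simp [hκ's]
    rw [h]
    exact abs_of_pos (mul_pos (hκ0 z hz) (div_pos two_pos (pow_pos (sub_pos.mpr (hx1 z hz)) 2)))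
  have hB : IsSemialgebraic ℚ B :=
    himage ▸ IsSemialgebraicMapOn.isSemialgebraic_image_holds hΦs subset_rfl hS
  have hident : ∀ z ∈ r.domain, r.integrand z = F (Φ z) * |(Φ' z).det| := fun z hz => by
    rw [hdet z hz, hint hz]
    simp only [F, Φ, hΩu, Function.update_self, hU]
    rw [kernel_identity (hκ0 z hz) (hx1 z hz), mul_assoc]
  have hintB : IntegrableOn F B := by
    rw [← himage]
    refine (integrableOn_image_iff_integrableOn_abs_det_fderiv_smul volume hmeas hderiv hinj F).mpr ?_
    refine r.integrableOn.congr_fun (fun z hz => ?_) hmeas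
    rw [smul_eq_mul, mul_comm]
    exact hident z hz
  refine ⟨⟨B, F, hB, isSemialgebraicFunOn_out slot hB (hΩs B hB), hintB⟩, rfl, fun _ _ => rfl, ?_⟩
  exact KZ.changeOfVariablesRel_subset_relations
    ⟨n, r, _, Φ, Φ', hΦs, hderiv, hinj, himage.symm, hident, rfl⟩

/-! ### The parameter function `κ z = (V, z ∘ natAdd 1)_{last}` of the stub -/

/-- The parameter coordinates `Fin.natAdd 1 i` are not the box slot `Fin.castAdd j 0`. [folklore] -/
theorem natAdd_ne_castAdd {j : ℕ} (i : Fin j) :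
    (Fin.natAdd 1 i : Fin (1 + j)) ≠ Fin.castAdd j (0 : Fin 1) := by
  intro h
  have := congrArg Fin.val h
  simp at this

/-- Updating the box slot does not change the parameter coordinates. [folklore] -/
theorem update_slot_natAdd {j : ℕ} (z : Fin (1 + j) → ℝ) (t : ℝ) (i : Fin j) :
    Function.update z (Fin.castAdd j 0) t (Fin.natAdd 1 i) = z (Fin.natAdd 1 i) :=
  Function.update_of_ne (natAdd_ne_castAdd i) _ _

/-- The kernel parameter `κ z` (last entry of the chain `V, z_{natAdd 1 0}, …`) has the constant
derivative `κ' = (0, proj_{natAdd 1 0}, …)_{last}`. [folklore] -/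
theorem hasFDerivAt_kappa {j : ℕ} (V : ℝ) (z : Fin (1 + j) → ℝ) :
    HasFDerivAt (fun z : Fin (1 + j) → ℝ =>
        (Fin.cons V (fun i : Fin j => z (Fin.natAdd 1 i)) : Fin (j + 1) → ℝ) (Fin.last j))
      ((Fin.cons (0 : (Fin (1 + j) → ℝ) →L[ℝ] ℝ)
        (fun i : Fin j => ContinuousLinearMap.proj (Fin.natAdd 1 i)) :
          Fin (j + 1) → ((Fin (1 + j) → ℝ) →L[ℝ] ℝ)) (Fin.last j)) z := by
  cases j with
  | zero =>
    simp only [Fin.last_zero, Fin.cons_zero]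
    exact hasFDerivAt_const V z
  | succ k =>
    have hl : Fin.last (k + 1) = (Fin.last k).succ := rfl
    simp only [hl, Fin.cons_succ]
    exact hasFDerivAt_apply _ z

/-- `κ'` kills the slot direction `e_slot`. [folklore] -/
theorem kappa'_single {j : ℕ} :
    ((Fin.cons (0 : (Fin (1 + j) → ℝ) →L[ℝ] ℝ)
        (fun i : Fin j => ContinuousLinearMap.proj (Fin.natAdd 1 i)) :
          Fin (j + 1) → ((Fin (1 + j) → ℝ) →L[ℝ] ℝ)) (Fin.last j))
      (Pi.single (Fin.castAdd j (0 : Fin 1)) 1) = 0 := by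
  cases j with
  | zero => simp
  | succ k =>
    have hl : Fin.last (k + 1) = (Fin.last k).succ := rfl
    rw [hl, Fin.cons_succ, ContinuousLinearMap.proj_apply, Pi.single_apply,
      if_neg (natAdd_ne_castAdd _)]

/-- `κ` is `ℚ`-semialgebraic on every `ℚ`-semialgebraic set (the algebraic constant `V` for
`j = 0`, a coordinate otherwise). [cite: KontsevichZagier2001, §1.1] -/
theorem isSemialgebraicFunOn_kappa {j : ℕ} {V : ℝ} (hV : IsAlgebraic ℚ V)
    {S : Set (Fin (1 + j) → ℝ)} (hS : IsSemialgebraic ℚ S) :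
    IsSemialgebraicFunOn ℚ S (fun z : Fin (1 + j) → ℝ =>
      (Fin.cons V (fun i : Fin j => z (Fin.natAdd 1 i)) : Fin (j + 1) → ℝ) (Fin.last j)) := by
  cases j with
  | zero =>
    simp only [Fin.last_zero, Fin.cons_zero]
    exact isSemialgebraicFunOn_const_of_isAlgebraic hS hV
  | succ k =>
    have hl : Fin.last (k + 1) = (Fin.last k).succ := rfl
    simp only [hl, Fin.cons_succ]
    exact isSemialgebraicFunOn_apply hS _

/-- The parameter weight `∏ g(vᵢ)`, `g(v) = 2/(1 + v²)`, is `ℚ`-semialgebraic. [folklore] -/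
theorem isSemialgebraicFunOn_omega {j : ℕ} (g : ℝ → ℝ) (hg : ∀ v, g v = 2 / (1 + v ^ 2))
    {S : Set (Fin (1 + j) → ℝ)} (hS : IsSemialgebraic ℚ S) :
    IsSemialgebraicFunOn ℚ S (fun y => ∏ i : Fin j, g (y (Fin.natAdd 1 i))) := by
  refine IsSemialgebraicFunOn.fun_finsetProd Finset.univ hS fun i _ => ?_
  refine (isSemialgebraicFunOn_aeval_div_aeval hS (2 : MvPolynomial (Fin (1 + j)) ℚ)
    (1 + MvPolynomial.X (Fin.natAdd 1 i) ^ 2) fun z _ => ?_).congr fun z _ => ?_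
  · simp only [map_add, map_one, map_pow, MvPolynomial.aeval_X]
    positivity
  · simp [hg]

end LadderBottom

open LadderBottom in
/-- **S2 (ladder bottom: the fibre Möbius chart).** At box dimension `1` the Bernoulli-parity
kernel is `U`, and `x ↦ W = v(1+x)/(1−x)` (`U(v;x) dx = dW/(1+W²)`, `W ∈ (v, ∞)`) is ONE change of
variables onto the region `B(j,V) = {chain strictly decreasing, positive, and W > v_last}` (the
box slot now holding `W`). [cite: KontsevichZagier2001, §1.2 rule (2)] -/
theorem stub_ladderBottom : ∀ (g : ℝ → ℝ) (U : ℝ → ℝ → ℝ), (∀ v, g v = 2 / (1 + v ^ 2)) → (∀ v s, U v s = 2 * v / ((1 - s) ^ 2 + v ^ 2 * (1 + s) ^ 2)) → ∀ (j : ℕ) (V : ℝ), IsAlgebraic ℚ V → 0 < V → ∀ (r : KZ.IntegralRep (1 + j)), r.domain = {z | z (Fin.castAdd j 0) ∈ Set.Ioo (0:ℝ) 1 ∧ StrictAnti (Fin.cons V (fun i : Fin j => z (Fin.natAdd 1 i)) : Fin (j + 1) → ℝ) ∧ 0 < (Fin.cons V (fun i : Fin j => z (Fin.natAdd 1 i))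 : Fin (j + 1) → ℝ) (Fin.last j)} → Set.EqOn r.integrand (fun z => (∏ i : Fin j, g (z (Fin.natAdd 1 i))) * U ((Fin.cons V (fun i : Fin j => z (Fin.natAdd 1 i)) : Fin (j + 1) → ℝ) (Fin.last j)) (z (Fin.castAdd j 0))) r.domain → ∃ (b : KZ.IntegralRep (1 + j)), b.domain = {y | StrictAnti (Fin.cons V (fun i : Fin j => y (Fin.natAdd 1 i)) : Fin (j + 1) → ℝ) ∧ 0 < (Fin.cons V (fun i : Fin j => y (Fin.natAdd 1 i)) : Fin (j + 1) → ℝ) (Fin.last j) ∧ (Fin.cons V (fun i : Fin j => y (Fin.natAdd 1 i)) : Fin (j + 1) → ℝ) (Fin.last j) < y (Fin.castAdd j 0)} ∧ Set.EqOn b.integrand (fun y => (∏ i : Fin j, g (y (Fin.natAdd 1 i))) * (1 / (1 + y (Fin.castAdd j 0) ^ 2))) b.domain ∧ KZ.of r - KZ.of b ∈ KZ.relations := by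
  intro g U hg hU j V hV _hV0 r hdom hint
  exact exists_rep_of_chart (Fin.castAdd j 0)
    (fun z : Fin (1 + j) → ℝ =>
      (Fin.cons V (fun i : Fin j => z (Fin.natAdd 1 i)) : Fin (j + 1) → ℝ) (Fin.last j))
    ((Fin.cons (0 : (Fin (1 + j) → ℝ) →L[ℝ] ℝ)
      (fun i : Fin j => ContinuousLinearMap.proj (Fin.natAdd 1 i)) :
        Fin (j + 1) → ((Fin (1 + j) → ℝ) →L[ℝ] ℝ)) (Fin.last j))
    (fun z : Fin (1 + j) → ℝ =>
      StrictAnti (Fin.cons V (fun i : Fin j => z (Fin.natAdd 1 i)) : Fin (j + 1) → ℝ))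
    (fun z : Fin (1 + j) → ℝ => ∏ i : Fin j, g (z (Fin.natAdd 1 i))) U hU
    (hasFDerivAt_kappa V) kappa'_single
    (fun z t => by simp only [update_slot_natAdd])
    (fun z t => by simp only [update_slot_natAdd])
    (fun z t => by simp only [update_slot_natAdd])
    (fun S hS => isSemialgebraicFunOn_kappa hV hS)
    (fun S hS => isSemialgebraicFunOn_omega g hg hS)
    r hdom hint

end Summit.KontsevichZagierPeriods.Theorems.HurwitzMicroSectorsHurwitzSectorComplement

end
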